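import Mathlib
import HarnessLib
import HarnessLib.Audit
import Summits.MatrixMultiplication.Statement
import Literature.Computability.AlgebraicComplexity.MatrixMultiplicationExponent
import Literature.Computability.AlgebraicComplexity.CohnUmansTPP
import Literature.Computability.AlgebraicComplexity.TensorRestrictionRank
import HarnessLib.Audit.Status.Attr

/-!
Route: GelfandPairHosts

DORMANT since 2026-08-26T05:42:23Z (reconciler: no traction for 8.4 d (last activity item-evidence-added at 2026-08-17T19:46:41Z); parked, not closed — `ledger route dormant route-MatrixMultiplication-GelfandPairHosts --off` to reactiva) — unstaffed, not closed; items shared with open routes are served there. `ledger route dormant <id> --off` reactivates.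

# Route GelfandPairHosts — matrix multiplication hosted in multiplicity-free permutation modules —
omega-free cost Sum d_pi^2, rigidity expected

X = GELFAND HOSTING (realises card gelfand-pair-module-hosts, sharpened): for every ε > 0 there are
a finite group G, a finite
G-set X that is MULTIPLICITY-FREE (the commutant of the permutation matrices P_g is commutative —
Gelfand pair (G, G_x);
CeccherinisilbersteScarabottiTolli2018 Cor 10.6.6) and a MODULE-TPP DESIGN of size (a,b,c), abc ≥ 2
— maps φ : [a]×[b] → G,
ψ : [b]×[c] → X, χ : [a]×[c] → X with φ(i,j)·ψ(j',k) = χ(i',k') ⟺ (i,j,k) = (i',j',k') — whose host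
cost
D(G,X) := dim span{P_g} = Σ_{π ⊂ ℂ[X]} d_π² is at most (abc)^{(2+ε)/3}. The design makes ⟨a,b,c⟩ a
coordinate restriction of the
action tensor T_{G,X}(y,g,x) = [g·x = y] (CohnUmans2003 Thm 2.3 moved from the regular module ℂ[G]
to ℂ[X]); for multiplicity-free X,
T_{G,X} ≅ ⊕_π ⟨d_π,d_π,1⟩ (matrix–VECTOR blocks), so R(T_{G,X}) = D exactly and (abc)^{ω/3} ≤ D with
NO ω on the right-hand side.
Lean: `∀ ε : ℝ, 0 < ε → ∃ (G : Type) (_ : Group G) (_ : Fintype G) (X : Type) (_ : Fintype X) (_ :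
DecidableEq X) (_ : MulAction G X) (a b c : ℕ) (φ : Fin a × Fin b → G) (ψ : Fin b × Fin c → X) (χ :
Fin a × Fin c → X), (∀ A B : Matrix X X ℂ, (∀ (g : G) (x y : X), A (g • x) (g • y) = A x y) → (∀ (g
: G) (x y : X), B (g • x) (g • y) = B x y) → A * B = B * A) ∧ 2 ≤ a * b * c ∧ (∀ (i i' : Fin a) (j
j' : Fin b) (k k' : Fin c), φ (i, j) • ψ (j', k) = χ (i', k') ↔ (i = i' ∧ j = j' ∧ k = k')) ∧
(Module.finrank ℂ (Submodule.span ℂ (Set.range fun g : G => Matrix.of fun y x : X => if g • x = y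
then (1 : ℂ) else 0)) : ℝ) ≤ ((a * b * c : ℕ) : ℝ) ^ ((2 + ε) / 3)`

## Assembly
Standard reductions only, all PROVED in the tree: a design makes matMulTensor ℂ a b c the coordinate
restriction of T_{G,X} along
(χ, φ, ψ) (tensorRestrictsTo_precomp; the design's ⟺ is literally the entry condition of
matMulTensor), so
(abc)^{ω/3} ≤ R(⟨a,b,c⟩) ≤ R(T_{G,X}) (rpow_omega_div_three_le_tensorRank,
TensorRestrictsTo.tensorRank_le) = D (RankFormula)
≤ (abc)^{(2+ε)/3}; abc ≥ 2 gives ω ≤ 2 + ε for every ε, and omega_two_le closes ω(ℂ) = 2.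
RankFormula (support, true, double-commutant
linear algebra) is the one non-elementary link and is kept explicit as an antecedent.

Rationale: WHY THIS LINE. Mechanism (card gelfand-pair-module-hosts): host ⟨a,b,c⟩ not in ℂ[G] (CohnUmans2003,
cost Σ d_π^ω, bootstrapped) nor in the adjacency
algebra of a Schurian coherent configuration (CohnUmans2013 Def 12 / Prop 14 / Conj 21: sets A,B,C ⊂
X, cost = rank r via s-rank with the
50% penalty ω ≤ (3ω_s−2)/2) but in the permutation MODULE ℂ[X] itself — the bicommutant ⊕_π End(V_π)
acting on ⊕_π V_π — where
multiplicity-freeness makes every Wedderburn block a matrix–vector product of rank exactly d_π², so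
the price tag D = Σ d_π² ≥ N²/r is
printed in advance and a single finite design certifies ω ≤ 3·log D/log(abc) with no limit.
Imported: finite harmonic analysis of Gelfand
pairs / permutation modules (CeccherinisilbersteScarabottiTolli2018 §10.6, §13.3) for the cost side;
Cohn–Umans TPP combinatorics for capacity.
What the planner adds (Sketch/NOTES): (i) a quotient-form design (F, Hs ⊂ G, P ⊂ X = G/H) is EXACTLY
a TPP triple (F⁻¹, Hs⁻¹, P·H) in G
with an H-saturated third leg (item SaturatedRealization), so CKSU2005 Thm 1.8 (proved in tree)
reads the same object as
(abc·|H|)^{ω/3} ≤ Σ_all d^ω — this DOMINATES the module reading for every ω < 3 whenever the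
stabiliser is small (all Frobenius/cyclotomic
affine hosts; the card's q^{1/4}-design would give ω ≤ 2.25 through CU03 but only 2.5 through the
module), and CKSU's wreath-product
triples are already saturated module designs; the module reading wins only for LARGE stabilisers
with SMALL D (transvection-type hosts,
D = 2N−2). (ii) Hence the honest expectation is RIGIDITY (crux 2, the card's Conjecture R,
generalising "abelian groups are useless",
CohnUmans2003 Lemma 3.1) — to be catalogued as a ModuleHostBarrier — with a sharply delimited
positive window (cruxes 3–4). No prior
route hosts in a non-regular module: GroupTheoreticSTPP is abelian STPP in ℂ[H],
ReesMunnRealization/OrbitHarmonicsHosts/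
WindowedCompletionRank use other ALGEBRAS, SnThresholdCensus censuses subgroup triples of S_n;
negatives index empty.

RANKED CRUXES. #0 GelfandHosting (target) — X as in § Thesis: multiplicity-free finite G-sets with
module-TPP designs of size (a,b,c), abc ≥ 2, and D(G,X) ≤ (abc)^{(2+ε)/3} for every ε > 0 (forces D
= N^{1+o(1)} and abc = N^{3/2−o(1)}, N = |X|). (why it might fail: Probably false (GelfandRigidity):
small-stabiliser hosts are dominated by CU03 on the saturated triple; the only large-stabiliser
hosts with D ≈ N found (transvection type) are abelian-by-index-2, capacity ≤ 4N; exact exponents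
needed on both sides.) [CohnUmans2003, CohnUmans2013, CohnKleinbergSzegedyUmans2005,
CeccherinisilbersteScarabottiTolli2018]
#2 GelfandRigidity (crux) — Conjecture R (card, NEGATIVE, kills X via KillGlue): there is C such
that for every finite group G, every multiplicity-free finite G-set X (N = |X|) and every module-TPP
design of size (a,b,c): abc ≤ N·(D(G,X)/N)^C. Generalises CohnUmans2003 Lemma 3.1 (D = N ⟺ abelian
image, then abc ≤ N, tight) and the card's affine lemma abc ≤ N·[G:A]² (item AffineCapacity); proved
⇒ catalogue a ModuleHostBarrier. [difficulty: L] (why it might fail: General (non-quotient) designs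
escape the saturation identity (pointwise stabilisers let φ(i,j')⁻¹φ(i,j) depend on i); a
large-stabiliser Gelfand pair with D ≈ N but TPP-capacity(G) ≥ |G|^{3/2}|H|^{-1/2} would refute it.)
[CohnUmans2003, CohnUmans2013, BlasiakCohnGrochowPrattUmans2023,
CeccherinisilbersteScarabottiTolli2018]
#3 BeatTheSquares (crux) — Some multiplicity-free finite G-set admits a module-TPP design with abc >
D(G,X) ("a module host beats the sum of the SQUARES" — the analogue of beating Σ d³,
CohnKleinbergSzegedyUmans2005 §2; it is the weakest consequence of X and gives at once a
module-hosted certificate ω ≤ 3 log D/log(abc) < 3). Smallest candidates: S_3^n ↷ [3]^n (D = 5^n <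
N^{3/2}; n = 2 needs a (3,3,3) or (4,4,2) design, the latter would give R(⟨4,4,2⟩) ≤ 25), dihedral
and transvection hosts (D = 2N−O(1), coset counting allows abc ≤ 4N), cyclotomic F_q ⋊ C_{q^{1/4}} ↷
F_q (card C2). [difficulty: M] (why it might fail: The sharp form of rigidity may be abc ≤ D (C = 1)
or even (abc)² ≤ N·D; by SaturatedRealization a quotient-form witness is a TPP triple (a,b,c|H|) in
G, and exhaustive TPP searches in groups of order ≤ 100 found nothing non-trivial (smallest known
⟨40,40,40⟩).) [CohnKleinbergSzegedyUmans2005, arXiv:1104.5097, arXiv:1305.0448,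
doi:10.1112/s1461157010000288, CohnUmans2013]
#4 SuperlinearCapacity (crux) — POSITIVE waypoint (X ⇒ this ⇒ BeatTheSquares; GelfandRigidity ⇒ its
negation): there is δ > 0 such that for every η > 0 some multiplicity-free finite G-set with N ≥ 2
and D(G,X) ≤ N^{1+η} carries a module-TPP design with abc ≥ N^{1+δ} — the card's "near-trivial
permutation character yet rich √N-tilings"; realistic witnesses must have LARGE stabilisers (small
ones are dominated by CU03) and small D. [deps: BeatTheSquares] [difficulty: open-problem] (why it
might fail: D ≤ N^{1+η} forces rank r ≥ N^{1−η}, i.e. an action that is regular up to N^{o(1)} or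
transvection-like; in every such family examined (affine, dihedral, transvection, wreath) abelian
pigeonholing caps abc at N·[G:A]^{O(1)}.) [CohnUmans2003, CohnUmans2013,
BlasiakChurchCohnGrochowNaslundSawinUmans2017]
#9 RankFormula (support) — For a multiplicity-free finite G-set X the action tensor T_{G,X}(y,g,x) =
[g·x = y] has tensor rank exactly D(G,X) = dim span{P_g} (= Σ_{π⊂ℂ[X]} d_π²): ≥ by the G-flattening,
≤ because the image of ℂ[G] in End ℂ[X] is ⊕_π End(V_π) acting on ⊕_π V_π (double commutant,
CeccherinisilbersteScarabottiTolli2018 §10.6), a direct sum of matrix–vector tensors ⟨d_π,d_π,1⟩ of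
rank d_π². Load-bearing for the Assembly. [difficulty: M] [CeccherinisilbersteScarabottiTolli2018,
Blaser2013,
lean:Literature.Computability.AlgebraicComplexity.card_le_tensorRank_of_linearIndependent]
#9 SaturatedRealization (support) — Quotient-form designs are saturated TPP triples: if G acts
transitively on X, F, Hs ⊂ G and P ⊂ X satisfy (f'⁻¹ f h⁻¹ h')·p = p' ⇒ f = f', h = h', p = p', then
(F⁻¹, Hs⁻¹, {g : g·x₀ ∈ P}) has the triple product property, so G realizes ⟨|F|, |Hs|, |P|·|G_{x₀}|⟩
(and CKSU2005_thm18_holds then gives (|F||Hs||P||G_{x₀}|)^{ω/3} ≤ Σ d^ω — the CU03 reading of the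
same object). Conversely such designs give module-TPP designs φ(i,j) = f_i h_j⁻¹, ψ(j,k) = h_j·p_k,
χ(i,k) = f_i·p_k. [difficulty: provable-now] [CohnUmans2003, CohnKleinbergSzegedyUmans2005,
lean:Literature.Computability.AlgebraicComplexity.CKSU2005_thm18_holds]
#9 AffineCapacity (support) — The card's capacity lemma in invariant form: if a subgroup A ≤ G is
abelian and acts regularly on X (affine hosts A ⋊ K ↷ A, [G:A] = |K|; dihedral), every quotient-form
design satisfies |F|·|Hs|·|P| ≤ N·[G:A]² — pigeonhole F and Hs into left A-cosets, inside one coset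
pair all f'⁻¹f, h⁻¹h' lie in A and form an abelian TPP configuration with P ≅ A, so CohnUmans2003
Lemma 3.1 (tree: RealizesTPP.mul_mul_le_card) bounds each block by N. [difficulty: provable-now]
[CohnUmans2003, lean:Literature.Computability.AlgebraicComplexity.RealizesTPP.mul_mul_le_card]
#9 KillGlue (support) — GelfandRigidity refutes the thesis: from a design one gets bc ≤ N, ac ≤ N
(ψ, χ injective) and ab ≤ D (the matrices P_{φ(i,j)} have private non-zero entries at (χ(i,k),
ψ(j,k))), and multiplicity-free ⇒ transitive ⇒ D ≥ N; with D ≤ (abc)^{(2+ε)/3} this forces D ≤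
N^{1+3ε/(4−ε)} and abc ≥ N^{3/(2+ε)}, contradicting abc ≤ N(D/N)^C once ε < ε₀(C). [difficulty:
provable-now] [CohnUmans2003, Blaser2013]

TWO-LAYER PLAN. GelfandRigidity ⇐ QuotientFormRigidity (designs (F,Hs,P); via SaturatedRealization +
a TPP-capacity bound for groups with a large
multiplicity-free subgroup) → GeneralToQuotient (general designs lose at most a factor (D/N)^{O(1)}
against quotient form) → GelfandRigidity.
BeatTheSquares, if it closes positively, splits nothing; if refuters establish abc ≤ D in all hosts
with N ≤ 64 the tenure planner
restates crux 3 as the sharp law `abc ≤ D` (negative) and re-ranks. SuperlinearCapacity ⇐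
LargeStabiliserHosts (multiplicity-free
actions with |G_x| ≥ N^{1/2}, D ≤ N^{1+η}) → DesignsInThem → SuperlinearCapacity.

KILL CRITERIA. GelfandRigidity proved ⇒ KillGlue gives ¬GelfandHosting: close
`refuted:GelfandHosting`, file the theorem as
Literature/Barriers/MatrixMultiplication/ModuleHostBarrier (technique class permutation-module-host)
and mark the card refuted-with-census.
¬BeatTheSquares proved (abc ≤ D always) ⇒ same closure, sharper barrier. SuperlinearCapacity refuted
alone ⇒ close (X ⇒ it).
A proof elsewhere of CKSU Conj 4.7 / ω = 2 moots the route. BeatTheSquares proved does NOT rescue X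
(only ω < 3 from a module host) but
reopens the design hunt: pivot to the witness family.

NOT DECOMPOSED YET. The sharp exponent in Rigidity (conjecturally C = 1, "never beat the squares",
or the square-root law (abc)² ≤ N·D — tight for abelian
regular actions); the structure theorem "D ≤ N^{1+η} ⇒ G has an abelian subgroup of index N^{O(η)}
acting with N^{1−O(η)} orbits" that a
Rigidity proof presumably needs; thin-multiplicity hosts (m_π ≤ d_π^{0.32}, blocks still flat by
Coppersmith — capped at 2.59 by counting,
card) and the group-association-scheme hosts (G×G ↷ G, D = Σ d⁴, designs ⊇ two-sided TPP) are
deliberately outside X; no definition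
items (everything is inlined over Mathlib's MulAction / Matrix / Module.finrank and the tree's
tensorRank, RealizesTPP).

CHEAPEST FALSIFIER. One kit job (refuter): enumerate transitive groups of degree N ≤ 30 (GAP
TransitiveGroups), keep the multiplicity-free ones with
D = Σ d_π² < N^{3/2}, and search module-TPP designs (quotient form first: F, Hs ⊂ G, P ⊂ X; then
general φ, ψ, χ) maximising abc;
report max abc / D and max (abc)²/(N·D) per host. Decisive small instances: S_3² ↷ [3]² (D = 25: is
there a (3,3,3) or (4,4,2) design?),
S_3³ ↷ [3]³ (D = 125 vs (9,9,3) = 243), D_q ↷ q-gon and F_2^n ⋊ (transvections with a common fixed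
hyperplane) ↷ F_2^n (D = 2N−2 vs the
coset bound 4N). Any abc > D closes crux 3 positively and yields R(⟨a,b,c⟩) ≤ D; uniform abc ≤ D
supports restating crux 3 as the sharp
rigidity law. Not run here (planner seat, compute-free hub).

NUMBERS. Cost floor D ≥ max(N, N²/r) (r = rank = number of suborbits); capacity ceilings bc ≤ N, ac
≤ N, ab ≤ min(D, |G|), so abc ≤ N·√D and a
certificate below 3 needs abc > D, below 2+ε needs D ≤ N^{1+3ε/4} and abc ≥ N^{3/2−3ε/4}.
Irreversibility of the host: R~(T_{G,X}) = D,
Q~(T_{G,X}) = N, so the CVZ barrier value is 2·log D/log N. Affine hosts A ⋊ K: D = Σ_{K-orbits O ⊂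
Â} |O|² ≤ N|K|, abc ≤ N|K|²
(AffineCapacity) ⇒ certificate ≥ 3(1+κ')/min(1+2κ, (3+κ)/2) ≥ 2.5 (κ = log_N|K| = 1/4, card); CU03
on the same saturated triple: 2.25.
Test hosts: S_3^n ↷ [3]^n: N = 3^n, D = 5^n, |G_x| = 2^n; dihedral D_q: D = 2q−1 (q odd), capacity ≤
4q; transvection host on F_2^n:
D = 2N−2, |G_x| = N/2, capacity ≤ 4N. Known small ranks for comparison: R(⟨3,3,3⟩) ∈ [19,23]
(Blaser2003, Laderman), R(⟨4,4,2⟩) ≤ 26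
(Hopcroft–Kerr). Items at open: 9 (1 target, 3 cruxes, 4 support, 1 assembly).

DEFINITION REQUESTS. None. Module-TPP designs, multiplicity-freeness (commutative commutant) and
D(G,X) = finrank of the span of the permutation matrices are
inlined one-liners over Mathlib (MulAction, Matrix, Submodule.span, Module.finrank) and the tree's
tensorRank / RealizesTPP; a named
`ModuleTPP` next to Literature.Combinatorics.Additive.TripleProductProperty can be requested later
if a second route wants it.

Novelty: Searches (2026-08-15): `lit search --hybrid "Gelfand pair permutation module triple product property
matrix multiplication"` (12 local
docs: Ceccherini-Silberstein–Scarabotti–Tolli ×2, none on MM); `lit search --source zbmath "triple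
product property matrix multiplication"`
(8: Neumann 2011, Hedtke–Murthy arXiv:1104.5097, Hart–Hedtke–Müller-Hannemann–Murthy
arXiv:1305.0448, Hedtke arXiv:1107.5973/1107.5969,
BCGPU arXiv:2410.14905); `lit galaxy search "triple product property" --star all` (13 rows: CKSU05,
Sawin 1702.00905, BCGPU 2025, Stothers,
Landsberg); `lit galaxy search "Gelfand pair" --star pdf` (20 rows, harmonic analysis only); arXiv
API rate-limited (429); full reads of
arXiv:1207.6528 pp. 10–15 and arXiv:2204.03826 §4 (Lemma 4.8); the 26 route files of the
sub-problem; negatives index (empty).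
Nearest prior art found: CohnUmans2013 (arXiv:1207.6528) Prop 14 / Def 12 / Thm 6 / Conj 21 /
§6.2–6.3 — TPP for group ACTIONS with all
three sets in X, hosted in the ADJACENCY algebra of the Schurian coherent configuration (the
commutant, dim r), cost through s-rank with
ω ≤ (3ω_s−2)/2; CohnUmans2003 Thm 2.3/4.1 and CohnKleinbergSzegedyUmans2005 Thm 1.8/7.1 (regular
module; wreath triples, which are
saturated); BlasiakCohnGrochowPrattUmans2023 Lemma 4.8 (K-TPP = slicing a compact subgroup back to
an honest TPP, not a module).
Delta: host in the permutation MODULE / bicommutant ⊕ End V_π (dim D = Σ d_π² ≥ N²/r) with designs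
(F, Hs ⊂ G, P ⊂ X), giving the ω-free
single-shot ine  [refs: 1104.5097, 1305.0448, 1107.5973, 2410.14905, 1207.6528, 2204.03826, CohnUmans2013, CohnUmans2003, CohnKleinbergSzegedyUmans2005, BlasiakCohnGrochowPrattUmans2023]

Barriers (technique_class: group-theoretic-approach, permutation-module-host, TPP): - technique_class: group-theoretic-approach, permutation-module-host, TPP
- Literature.Barriers.MatrixMultiplication.IrreversibilityBarrier: APPLIES (designs are monomial
restrictions of the fixed tensor T_{G,X}; R~ = D, Q~ = N give the CVZ Thm 9 value 2 log D/log N);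
evaded only along families with D = N^{1+o(1)} — exactly what the target demands (CVZ's own evasion
(i), i(t_k) → 1); it is why rank-2 and rank-3 actions are hopeless.
- Literature.Barriers.MatrixMultiplication.UnstableTensorBarrier: T_{G,X} ≅ ⊕⟨d_π,d_π,1⟩ is UNSTABLE
as soon as the d_π are not all equal (weights favouring large blocks), so Bläser–Lysikov Thm 16 bars
every bounded-size family of such hosts; the route uses hosts of unbounded size (their evasion (i))
and concedes each single host certifies > 2.
- Literature.Barriers.MatrixMultiplication.UniversalMethodBarrier: same content as irreversibility
here (slice rank of T_{G,X} ≤ N): ω_u(T_{G,X}) ≥ 2 log D/log N; evaded only as D/N → N^{o(1)}.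
- Literature.Barriers.MatrixMultiplication.QuasirandomBarrier: bites when the non-trivial
constituents of ℂ[X] are large (BCGPU23 Thm 3.2 transfers to G-sets); the route needs the opposite
regime D ≈ N, so it is evaded by design — the live obstruction is abelian counting
(GelfandRigidity), not mixing.
- Literature.Barriers.MatrixMultiplication.NormalizerBarrier: stated for three SUBGROUPS through Σ
d^ω; by SaturatedRealization a quotient-form design is a subset triple with one H-saturated leg, so
Rem. 3.7-type subset

History (route lifecycle, newest last):
- 2026-08-16T04:10:46Z · AUTO-CRUX (backfill): GelfandHosting — hypotheses of the deciding theorem that nothing in the route derives are cruxes (operator:999:1085951)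
- 2026-08-26T05:42:23Z · DORMANT — reconciler: no traction for 8.4 d (last activity item-evidence-added at 2026-08-17T19:46:41Z); parked, not closed — `ledger route dormant route-MatrixMultiplica (operator:999:730447)

sub-problem: MatrixMultiplication · status: dormant · opened planner-plancard-MatrixMultiplication-MatrixM-dd00a14a-0 2026-08-15T12:08:44Z · rev 1 · ledger route-MatrixMultiplication-GelfandPairHosts
GENERATED by the gate from the ledger (D-0016/17). Provers cite these decls: `theorem foo : Summit.MatrixMultiplication.MatrixMultiplication.Theses.GelfandPairHosts.<Decl> := …` in Summits/MatrixMultiplication/MatrixMultiplication/Theorems/<Name>.lean.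
-/

namespace Summit.MatrixMultiplication.MatrixMultiplication.Theses.GelfandPairHosts

open scoped BigOperators Topology Manifold Classical MeasureTheory ProbabilityTheory Matrix InnerProductSpace ComplexConjugate ContinuousMap
open Filter Set Function TopologicalSpace MeasureTheory

attribute [summit_statement] _root_.MatrixMultiplication

/-- item stmt-MatrixMultiplication-7381 · crux (kind.auto-crux: conjecture-grade) · rank 0 · open · by planner
why it might fail: Probably false (GelfandRigidity): small-stabiliser hosts are dominated by CU03 on the saturated triple; the only large-stabiliser hosts with D ≈ N found (transvection type) are abelian-by-index-2, capacity ≤ 4N; exact exponents needed on both sides.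
sources: CohnUmans2003, CohnUmans2013, CohnKleinbergSzegedyUmans2005, CeccherinisilbersteScarabottiTolli2018
[target] X as in § Thesis: multiplicity-free finite G-sets with module-TPP designs of size (a,b,c),
abc ≥ 2, and D(G,X) ≤ (abc)^{(2+ε)/3} for every ε > 0 (forces D = N^{1+o(1)} and abc = N^{3/2−o(1)},
N = |X|). -/
@[route_item "route-MatrixMultiplication-GelfandPairHosts", crux]
def GelfandHosting : Prop :=
  ∀ ε : ℝ, 0 < ε → ∃ (G : Type) (_ : Group G) (_ : Fintype G) (X : Type) (_ : Fintype X) (_ : DecidableEq X) (_ : MulAction G X) (a b c : ℕ) (φ : Fin a × Fin b → G) (ψ : Fin b × Fin c → X) (χ : Fin a × Fin c → X), (∀ A B : Matrix X X ℂ, (∀ (g : G) (x y : X), A (g • x) (g • y) = A x y) → (∀ (g : G) (x y : X), B (g • x) (g • y) = B x y) → A * B = B * A) ∧ 2 ≤ a * b * c ∧ (∀ (i i' : Fin a) (j j' : Fin b) (k k' : Fin c), φ (i, j) • ψ (j', k) = χ (i', k') ↔ (i = i' ∧ j = j' ∧ k = k')) ∧ (Module.finrank ℂ (Submodule.span ℂ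 (Set.range fun g : G => Matrix.of fun y x : X => if g • x = y then (1 : ℂ) else 0)) : ℝ) ≤ ((a * b * c : ℕ) : ℝ) ^ ((2 + ε) / 3)

/-- item stmt-MatrixMultiplication-7382 · crux · rank 2 · open · by planner
why it might fail: General (non-quotient) designs escape the saturation identity (pointwise stabilisers let φ(i,j')⁻¹φ(i,j) depend on i); a large-stabiliser Gelfand pair with D ≈ N but TPP-capacity(G) ≥ |G|^{3/2}|H|^{-1/2} would refute it.
sources: CohnUmans2003, CohnUmans2013, BlasiakCohnGrochowPrattUmans2023, CeccherinisilbersteScarabottiTolli2018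
[crux] Conjecture R (card, NEGATIVE, kills X via KillGlue): there is C such that for every finite
group G, every multiplicity-free finite G-set X (N = |X|) and every module-TPP design of size
(a,b,c): abc ≤ N·(D(G,X)/N)^C. Generalises CohnUmans2003 Lemma 3.1 (D = N ⟺ abelian image, then abc
≤ N, tight) and the card's affine lemma abc ≤ N·[G:A]² (item AffineCapacity); proved ⇒ catalogue a
ModuleHostBarrier. [difficulty: L] -/
@[route_item "route-MatrixMultiplication-GelfandPairHosts"]
def GelfandRigidity : Prop :=
  ∃ C : ℝ, ∀ (G : Type) [Group G] [Fintype G] (X : Type) [Fintype X] [DecidableEq X] [MulAction G X] (a b c : ℕ) (φ : Fin a × Fin b → G) (ψ : Fin b × Fin c → X) (χ : Fin a × Fin c → X), (∀ A B : Matrix X X ℂ, (∀ (g : G) (x y : X), A (g • x) (g • y) = A x y) → (∀ (g : G) (x y : X), B (g • x) (g • y) = B x y) → A * B = B * A) → (∀ (i i' : Fin a) (j j' : Fin b) (k k' : Fin c), φ (i, j) • ψ (j', k) = χ (i', k') ↔ (i = i' ∧ j = j' ∧ k = k')) → ((a * b * c : ℕ) : ℝ) * (Fintype.card X : ℝ)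 ^ C ≤ (Fintype.card X : ℝ) * (Module.finrank ℂ (Submodule.span ℂ (Set.range fun g : G => Matrix.of fun y x : X => if g • x = y then (1 : ℂ) else 0)) : ℝ) ^ C

/-- item stmt-MatrixMultiplication-7383 · crux · rank 3 · closed · proved by Summit.MatrixMultiplication.MatrixMultiplication.Theorems.beatTheSquares_proof @ 91f80d50ff3a (prover) · by planner
why it might fail: The sharp form of rigidity may be abc ≤ D (C = 1) or even (abc)² ≤ N·D; by SaturatedRealization a quotient-form witness is a TPP triple (a,b,c|H|) in G, and exhaustive TPP searches in groups of order ≤ 100 found nothing non-trivial (smallest known ⟨40,40,40⟩).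
sources: CohnKleinbergSzegedyUmans2005, arXiv:1104.5097, arXiv:1305.0448, doi:10.1112/s1461157010000288, CohnUmans2013
[crux] Some multiplicity-free finite G-set admits a module-TPP design with abc > D(G,X) ("a module
host beats the sum of the SQUARES" — the analogue of beating Σ d³, CohnKleinbergSzegedyUmans2005 §2;
it is the weakest consequence of X and gives at once a module-hosted certificate ω ≤ 3 log
D/log(abc) < 3). Smallest candidates: S_3^n ↷ [3]^n (D = 5^n < N^{3/2}; n = 2 needs a (3,3,3) or
(4,4,2) design, the latter would give R(⟨4,4,2⟩) ≤ 25), dihedral and transvection hosts (D =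
2N−O(1), coset counting allows abc ≤ 4N), cyclotomic F_q ⋊ C_{q^{1/4}} ↷ F_q (card C2). [difficulty:
M] -/
@[route_item "route-MatrixMultiplication-GelfandPairHosts"]
def BeatTheSquares : Prop :=
  ∃ (G : Type) (_ : Group G) (_ : Fintype G) (X : Type) (_ : Fintype X) (_ : DecidableEq X) (_ : MulAction G X) (a b c : ℕ) (φ : Fin a × Fin b → G) (ψ : Fin b × Fin c → X) (χ : Fin a × Fin c → X), (∀ A B : Matrix X X ℂ, (∀ (g : G) (x y : X), A (g • x) (g • y) = A x y) → (∀ (g : G) (x y : X), B (g • x) (g • y) = B x y) → A * B = B * A) ∧ (∀ (i i' : Fin a) (j j' : Fin b) (k k' : Fin c), φ (i, j) • ψ (j', k) = χ (i', k') ↔ (i = i' ∧ j = j' ∧ k = k')) ∧ Module.finrank ℂ (Submodule.span ℂ (Set.range fun g : G => Matrix.of fun y x : X => if g • x = y then (1 : ℂ) else 0)) < a * b * c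

-- `BeatTheSquares` holds: proved by `Summit.MatrixMultiplication.MatrixMultiplication.Theorems.beatTheSquares_proof` @ 91f80d50ff3a (its module imports this route file, so no `_holds` link can be stated here).

/-- item stmt-MatrixMultiplication-7384 · crux · rank 4 · open · by planner
why it might fail: D ≤ N^{1+η} forces rank r ≥ N^{1−η}, i.e. an action that is regular up to N^{o(1)} or transvection-like; in every such family examined (affine, dihedral, transvection, wreath) abelian pigeonholing caps abc at N·[G:A]^{O(1)}.
sources: CohnUmans2003, CohnUmans2013, BlasiakChurchCohnGrochowNaslundSawinUmans2017
[crux] POSITIVE waypoint (X ⇒ this ⇒ BeatTheSquares; GelfandRigidity ⇒ its negation): there is δ > 0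
such that for every η > 0 some multiplicity-free finite G-set with N ≥ 2 and D(G,X) ≤ N^{1+η}
carries a module-TPP design with abc ≥ N^{1+δ} — the card's "near-trivial permutation character yet
rich √N-tilings"; realistic witnesses must have LARGE stabilisers (small ones are dominated by CU03)
and small D. [deps: BeatTheSquares] [difficulty: open-problem] -/
@[route_item "route-MatrixMultiplication-GelfandPairHosts"]
def SuperlinearCapacity : Prop :=
  ∃ δ : ℝ, 0 < δ ∧ ∀ η : ℝ, 0 < η → ∃ (G : Type) (_ : Group G) (_ : Fintype G) (X : Type) (_ : Fintype X) (_ : DecidableEq X) (_ : MulAction G X) (a b c : ℕ) (φ : Fin a × Fin b → G) (ψ : Fin b × Fin c → X) (χ : Fin a × Fin c → X), (∀ A B : Matrix X X ℂ, (∀ (g : G) (x y : X), A (g • x) (g • y) = A x y) → (∀ (g : G) (x y : X), B (g • x) (g • y) = B x y) → A * B = B * A) ∧ 2 ≤ Fintype.card X ∧ (∀ (i i' : Fin a) (j j' : Fin b) (k k' : Fin c), φ (i, j) • ψ (j', k) = χ (i', k') ↔ (i = i' ∧ j = j' ∧ k = k')) ∧ (Module.finrank ℂ (Submodule.span ℂ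 (Set.range fun g : G => Matrix.of fun y x : X => if g • x = y then (1 : ℂ) else 0)) : ℝ) ≤ (Fintype.card X : ℝ) ^ (1 + η) ∧ (Fintype.card X : ℝ) ^ (1 + δ) ≤ ((a * b * c : ℕ) : ℝ)

/-- item stmt-MatrixMultiplication-7385 · support · rank 9 · closed · proved by Summit.MatrixMultiplication.MatrixMultiplication.Theorems.rankFormula_proof @ 2f1510a3a420 (prover) · by planner
sources: CeccherinisilbersteScarabottiTolli2018, Blaser2013, lean:Literature.Computability.AlgebraicComplexity.card_le_tensorRank_of_linearIndependent
[support] For a multiplicity-free finite G-set X the action tensor T_{G,X}(y,g,x) = [g·x = y] has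
tensor rank exactly D(G,X) = dim span{P_g} (= Σ_{π⊂ℂ[X]} d_π²): ≥ by the G-flattening, ≤ because the
image of ℂ[G] in End ℂ[X] is ⊕_π End(V_π) acting on ⊕_π V_π (double commutant,
CeccherinisilbersteScarabottiTolli2018 §10.6), a direct sum of matrix–vector tensors ⟨d_π,d_π,1⟩ of
rank d_π². Load-bearing for the Assembly. [difficulty: M] -/
@[route_item "route-MatrixMultiplication-GelfandPairHosts", crux]
def RankFormula : Prop :=
  ∀ (G : Type) [Group G] [Fintype G] (X : Type) [Fintype X] [DecidableEq X] [MulAction G X], (∀ A B : Matrix X X ℂ, (∀ (g : G) (x y : X), A (g • x) (g • y) = A x y) → (∀ (g : G) (x y : X), B (g • x) (g • y) = B x y) → A * B = B * A) → Literature.Computability.AlgebraicComplexity.tensorRank (fun (y : X) (g : G) (x : X) => if g • x = y then (1 : ℂ) else 0) = Module.finrank ℂ (Submodule.span ℂ (Set.range fun g : G => Matrix.of fun y x : X => if g • x = y then (1 : ℂ) else 0))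

-- `RankFormula` holds: proved by `Summit.MatrixMultiplication.MatrixMultiplication.Theorems.rankFormula_proof` @ 2f1510a3a420 (its module imports this route file, so no `_holds` link can be stated here).

/-- item stmt-MatrixMultiplication-7386 · support · rank 9 · closed · proved by Summit.MatrixMultiplication.MatrixMultiplication.Theorems.SaturatedRealization_proof @ 657f3200cf4f (prover) · by planner
sources: CohnUmans2003, CohnKleinbergSzegedyUmans2005, lean:Literature.Computability.AlgebraicComplexity.CKSU2005_thm18_holds
[support] Quotient-form designs are saturated TPP triples: if G acts transitively on X, F, Hs ⊂ G
and P ⊂ X satisfy (f'⁻¹ f h⁻¹ h')·p = p' ⇒ f = f', h = h', p = p', then (F⁻¹, Hs⁻¹, {g : g·x₀ ∈ P})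
has the triple product property, so G realizes ⟨|F|, |Hs|, |P|·|G_{x₀}|⟩ (and CKSU2005_thm18_holds
then gives (|F||Hs||P||G_{x₀}|)^{ω/3} ≤ Σ d^ω — the CU03 reading of the same object). Conversely
such designs give module-TPP designs φ(i,j) = f_i h_j⁻¹, ψ(j,k) = h_j·p_k, χ(i,k) = f_i·p_k.
[difficulty: provable-now] -/
@[route_item "route-MatrixMultiplication-GelfandPairHosts"]
def SaturatedRealization : Prop :=
  ∀ (G : Type) [Group G] [Fintype G] (X : Type) [Fintype X] [DecidableEq X] [MulAction G X] (x₀ : X) (F Hs : Finset G) (P : Finset X), (∀ x : X, ∃ g : G, g • x₀ = x) → (∀ f ∈ F, ∀ f' ∈ F, ∀ h ∈ Hs, ∀ h' ∈ Hs, ∀ p ∈ P, ∀ p' ∈ P, (f'⁻¹ * f * h⁻¹ * h') • p = p' → f = f' ∧ h = h' ∧ p = p') → Literature.Computability.AlgebraicComplexity.RealizesTPP G F.card Hs.card (P.card * Nat.card (MulAction.stabilizer G x₀))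

-- `SaturatedRealization` holds: proved by `Summit.MatrixMultiplication.MatrixMultiplication.Theorems.SaturatedRealization_proof` @ 657f3200cf4f (its module imports this route file, so no `_holds` link can be stated here).

/-- item stmt-MatrixMultiplication-7387 · support · rank 9 · closed · proved by Summit.MatrixMultiplication.MatrixMultiplication.Theorems.affineCapacity_proof @ 435cacda3ce6 (prover) · by planner
sources: CohnUmans2003, lean:Literature.Computability.AlgebraicComplexity.RealizesTPP.mul_mul_le_card
[support] The card's capacity lemma in invariant form: if a subgroup A ≤ G is abelian and acts
regularly on X (affine hosts A ⋊ K ↷ A, [G:A] = |K|; dihedral), every quotient-form design satisfies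
|F|·|Hs|·|P| ≤ N·[G:A]² — pigeonhole F and Hs into left A-cosets, inside one coset pair all f'⁻¹f,
h⁻¹h' lie in A and form an abelian TPP configuration with P ≅ A, so CohnUmans2003 Lemma 3.1 (tree:
RealizesTPP.mul_mul_le_card) bounds each block by N. [difficulty: provable-now] -/
@[route_item "route-MatrixMultiplication-GelfandPairHosts"]
def AffineCapacity : Prop :=
  ∀ (G : Type) [Group G] [Fintype G] (X : Type) [Fintype X] [DecidableEq X] [MulAction G X] (A : Subgroup G) (F Hs : Finset G) (P : Finset X), (∀ a ∈ A, ∀ a' ∈ A, a * a' = a' * a) → (∀ x y : X, ∃! a : G, a ∈ A ∧ a • x = y) → (∀ f ∈ F, ∀ f' ∈ F, ∀ h ∈ Hs, ∀ h' ∈ Hs, ∀ p ∈ P, ∀ p' ∈ P, (f'⁻¹ * f * h⁻¹ * h') • p = p' → f = f' ∧ h = h' ∧ p = p') → F.card * Hs.card * P.card ≤ Fintype.card X * A.index ^ 2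

-- `AffineCapacity` holds: proved by `Summit.MatrixMultiplication.MatrixMultiplication.Theorems.affineCapacity_proof` @ 435cacda3ce6 (its module imports this route file, so no `_holds` link can be stated here).

/-- item stmt-MatrixMultiplication-7388 · support · rank 9 · closed · proved by Summit.MatrixMultiplication.MatrixMultiplication.Theorems.killGlue_proof @ 98fbf36d5a5c (prover) · by planner
sources: CohnUmans2003, Blaser2013
[support] GelfandRigidity refutes the thesis: from a design one gets bc ≤ N, ac ≤ N (ψ, χ injective)
and ab ≤ D (the matrices P_{φ(i,j)} have private non-zero entries at (χ(i,k), ψ(j,k))), and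
multiplicity-free ⇒ transitive ⇒ D ≥ N; with D ≤ (abc)^{(2+ε)/3} this forces D ≤ N^{1+3ε/(4−ε)} and
abc ≥ N^{3/(2+ε)}, contradicting abc ≤ N(D/N)^C once ε < ε₀(C). [difficulty: provable-now] -/
@[route_item "route-MatrixMultiplication-GelfandPairHosts"]
def KillGlue : Prop :=
  GelfandRigidity → ¬ GelfandHosting

-- `KillGlue` holds: proved by `Summit.MatrixMultiplication.MatrixMultiplication.Theorems.killGlue_proof` @ 98fbf36d5a5c (its module imports this route file, so no `_holds` link can be stated here).

/-- item stmt-MatrixMultiplication-7389 · assembly · rank 1 · closed · proved by Summit.MatrixMultiplication.MatrixMultiplication.Theorems.gelfandPairHosts_assembly_proof @ 437392e1324b (prover) · by planner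
sources: CohnUmans2003, Blaser2013, lean:Literature.Computability.AlgebraicComplexity.rpow_omega_div_three_le_tensorRank, lean:Literature.Computability.AlgebraicComplexity.tensorRestrictsTo_precomp
[assembly] GelfandHosting → RankFormula → ω(ℂ) = 2. -/
@[route_item "route-MatrixMultiplication-GelfandPairHosts"]
def Assembly : Prop :=
  GelfandHosting → RankFormula → MatrixMultiplication

-- `Assembly` holds: proved by `Summit.MatrixMultiplication.MatrixMultiplication.Theorems.gelfandPairHosts_assembly_proof` @ 437392e1324b (its module imports this route file, so no `_holds` link can be stated here).

/-! D-0027 §2.1 — DECIDING THEOREM (planner-authored via `route open/edit --closes-file`; by planner-rbadge-MatrixMultiplication-GelfandPai-b448bd71-g2-0 2026-08-15T16:18:45Z):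
its hypotheses are this route's items and its conclusion the sub-problem Statement (glue_lint), and it elaborates with this file. -/

/-- DECIDING THEOREM (D-0027 §2.1). The target `GelfandHosting` and the support `RankFormula`
decide `ω(ℂ) = 2`; everything else is proved in the tree: a module-TPP design makes `⟨a,b,c⟩`
the coordinate restriction of the action tensor `T_{G,X}(y,g,x) = [g·x = y]` along `(χ, φ, ψ)`
(`tensorRestrictsTo_precomp`, `TensorRestrictsTo.tensorRank_le`), so
`R(⟨a,b,c⟩) ≤ R(T_{G,X}) = D(G,X)` (`RankFormula`) `≤ (abc)^{(2+ε)/3}`; Bläser 2013 Thm 5.9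
(`omega_le_three_mul_logb_of_tensorRank_le`, proved) gives `ω ≤ 3·log_{abc} D ≤ 2 + ε` for every
`ε > 0`, and `omega_two_le` closes `ω(ℂ) = 2`. -/
@[closes "route-MatrixMultiplication-GelfandPairHosts"] theorem closes (hX : GelfandHosting) (hR : RankFormula) : MatrixMultiplication := by
  rw [MatrixMultiplication_iff]
  refine le_antisymm ?_ (Literature.Computability.AlgebraicComplexity.omega_two_le ℂ)
  refine le_of_forall_pos_le_add fun ε hε => ?_
  obtain ⟨G, iG, iFG, X, iFX, iDX, iMA, a, b, c, φ, ψ, χ, hmf, habc, hdes, hD⟩ := hX ε hε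
  -- the design restricts the action tensor `T_{G,X}` to `⟨a,b,c⟩`
  have hres : Literature.Computability.AlgebraicComplexity.TensorRestrictsTo
      (fun (y : X) (g : G) (x : X) => if g • x = y then (1 : ℂ) else 0)
      (Literature.Computability.AlgebraicComplexity.matMulTensor ℂ a b c) := by
    haveI : DecidableEq G := Classical.decEq G
    have e : Literature.Computability.AlgebraicComplexity.matMulTensor ℂ a b c =
        fun p q r => (fun (y : X) (g : G) (x : X) => if g • x = y then (1 : ℂ) else 0)
          (χ p) (φ q) (ψ r) := by
      funext p q r
      obtain ⟨i', k'⟩ := p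
      obtain ⟨i, j⟩ := q
      obtain ⟨j', k⟩ := r
      show (if (i' = i ∧ j = j' ∧ k' = k) then (1 : ℂ) else 0) =
        (if φ (i, j) • ψ (j', k) = χ (i', k') then (1 : ℂ) else 0)
      refine if_congr ?_ rfl rfl
      rw [hdes i i' j j' k k']
      exact ⟨fun ⟨h1, h2, h3⟩ => ⟨h1.symm, h2, h3.symm⟩, fun ⟨h1, h2, h3⟩ => ⟨h1.symm, h2, h3.symm⟩⟩
    rw [e]
    exact Literature.Computability.AlgebraicComplexity.tensorRestrictsTo_precomp _ χ φ ψ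
  -- hence `R(⟨a,b,c⟩) ≤ R(T_{G,X}) = D(G,X)`
  have hle := hres.tensorRank_le.trans (hR G X hmf).le
  have h1 : 1 < a * b * c := habc
  have hq : (1 : ℝ) < ((a * b * c : ℕ) : ℝ) := by exact_mod_cast h1
  -- Bläser 2013 Thm 5.9 + `D ≤ (abc)^{(2+ε)/3}`
  have key : ∀ r : ℕ, Literature.Computability.AlgebraicComplexity.tensorRank
      (Literature.Computability.AlgebraicComplexity.matMulTensor ℂ a b c) ≤ r →
      (r : ℝ) ≤ ((a * b * c : ℕ) : ℝ) ^ ((2 + ε) / 3) →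
      Literature.Computability.AlgebraicComplexity.omega ℂ ≤ 2 + ε := by
    intro r hr hrle
    have hω := Literature.Computability.AlgebraicComplexity.omega_le_three_mul_logb_of_tensorRank_le
      ℂ a b c r h1 hr
    have hlogb : Real.logb ((a * b * c : ℕ) : ℝ) (r : ℝ) ≤ (2 + ε) / 3 := by
      rcases Nat.eq_zero_or_pos r with hr0 | hrpos
      · subst hr0
        simp only [Nat.cast_zero, Real.logb_zero]
        positivity
      · have hrpos' : (0 : ℝ) < (r : ℝ) := by exact_mod_cast hrpos
        rw [Real.logb_le_iff_le_rpow hq hrpos']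
        exact hrle
    linarith
  exact key _ hle hD

end Summit.MatrixMultiplication.MatrixMultiplication.Theses.GelfandPairHosts
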